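import Mathlib
import HarnessLib
import Literature.MathematicalPhysics.QuantumFieldTheory.Sweep1

/-!
# `CurvatureKernelBound` — stub `SwapReflectionPositivity` (F2), part 1/4: swap-mirror geometry

Support file for crux `stmt-QuantumFields-11687` (`PencilRigidity.CurvatureKernelBound`), line
`coupling-trichotomy`, stub `SwapReflectionPositivity`: reflection positivity of the free-boundary
Wilson lattice gauge measure on the cube `{-L,…,L}⁴ ⊆ ℤ⁴` for the DIAGONAL site mirror `x i = x j`
(Fröhlich–Israel–Lieb–Simon, Comm. Math. Phys. 62 (1978) 1, Thm. 2.1; Osterwalder–Seiler, Ann. Phys.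
110 (1978) 440, §2). This part: the swap `θ x = x ∘ swap i j` on sites, links `(x, k) ↦ (θx, σk)` and
plaquettes (plane pair re-sorted), invariance of the box and of `plaquettesIn`, and the classification
of plaquettes (positive / negative / mirror / cut) and links (positive / mirror) by the levels
`x i - x j` of their corners, with the facts the mechanism needs (`θ` exchanges positive and negative
plaquettes, fixes mirror plaquettes and mirror links, sends positive non-mirror links out of the
positive half; links of positive plaquettes are positive, …).

Design: the files of this stub are theorem-only, so the swap, the classes and the action pieces are
written inline (as explicit lambdas / formulas) in every statement; all helpers live in the
sub-namespace `SwapRP`. [folklore]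
-/

noncomputable section

open MeasureTheory
open scoped ComplexConjugate ComplexOrder
open Literature.MathematicalPhysics.QuantumFieldTheory Literature.Probability.LatticeModels

namespace Summit.QuantumFields.YangMills.Theorems.CurvatureKernel

namespace SwapRP

/-! ## A four-way split of finite sums -/

section Combinatorics

/-- Splitting a finite sum along four exhaustive, mutually exclusive classes. [folklore] -/
theorem sum_split_four {α M : Type*} [AddCommMonoid M] (s : Finset α) (f : α → M)
    (P Q R T : α → Prop) [DecidablePred P] [DecidablePred Q] [DecidablePred R] [DecidablePred T]
    (hex : ∀ a ∈ s, P a ∨ Q a ∨ R a ∨ T a) (hQP : ∀ a, Q a → ¬ P a) (hRP : ∀ a, R a → ¬ P a)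
    (hRQ : ∀ a, R a → ¬ Q a) (hT : ∀ a, T a → ¬ P a ∧ ¬ Q a ∧ ¬ R a) :
    ∑ a ∈ s, f a =
      ∑ a ∈ s.filter P, f a + ∑ a ∈ s.filter Q, f a + ∑ a ∈ s.filter R, f a + ∑ a ∈ s.filter T, f a
          := by
  have h1 := Finset.sum_filter_add_sum_filter_not s P f
  have h2 := Finset.sum_filter_add_sum_filter_not (s.filter fun a => ¬ P a) Q f
  have h3 := Finset.sum_filter_add_sum_filter_not ((s.filter fun a => ¬ P a).filter fun a => ¬ Q a)
      R f
  have e1 : (s.filter fun a => ¬ P a).filter Q = s.filter Q := by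
    ext a
    simp only [Finset.mem_filter]
    exact ⟨fun h => ⟨h.1.1, h.2⟩, fun h => ⟨⟨h.1, hQP a h.2⟩, h.2⟩⟩
  have e2 : ((s.filter fun a => ¬ P a).filter fun a => ¬ Q a).filter R = s.filter R := by
    ext a
    simp only [Finset.mem_filter]
    exact ⟨fun h => ⟨h.1.1.1, h.2⟩, fun h => ⟨⟨⟨h.1, hRP a h.2⟩, hRQ a h.2⟩, h.2⟩⟩
  have e3 : ((s.filter fun a => ¬ P a).filter fun a => ¬ Q a).filter (fun a => ¬ R a) = s.filter T
      := by
    ext a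
    simp only [Finset.mem_filter]
    constructor
    · rintro ⟨⟨⟨ha, hp⟩, hq⟩, hr⟩
      rcases hex a ha with hc | hc | hc | hc
      · exact absurd hc hp
      · exact absurd hc hq
      · exact absurd hc hr
      · exact ⟨ha, hc⟩
    · rintro ⟨ha, ht⟩
      obtain ⟨hp, hq, hr⟩ := hT a ht
      exact ⟨⟨⟨ha, hp⟩, hq⟩, hr⟩
  rw [← h1, ← h2, ← h3, e1, e2, e3]
  abel


variable {G : Type*} [Group G] [TopologicalSpace G] [IsTopologicalGroup G] [CompactSpace G]
variable {N : ℕ} (ρ : G →* Matrix (Fin N) (Fin N) ℂ) {i j : Fin 4}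

end Combinatorics

/-! ## Geometry of the diagonal swap `x ↦ x ∘ swap i j` on `ℤ⁴` -/

section SwapGeometry

/-- The swap of two coordinates is an involution on sites. [folklore] -/
theorem swapSite_swapSite (i j : Fin 4) (x : Site 4) : ((x ∘ Equiv.swap i j) ∘ Equiv.swap i j) = x
    := by
  funext m
  simp only [Function.comp_apply, Equiv.swap_apply_self]

/-- `θ(x + e_k) = θ x + e_{σ k}` for the swap `θ x = x ∘ σ`, `σ = swap i j`. [folklore] -/
theorem add_single_comp_swap (i j k : Fin 4) (x : Site 4) :
    ((x + Pi.single k 1 : Site 4) ∘ Equiv.swap i j) = (x ∘ Equiv.swap i j) + Pi.single (Equiv.swap i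
        j k) 1 := by
  funext m
  simp only [Function.comp_apply, Pi.add_apply, Pi.single_apply]
  congr 1
  by_cases h : Equiv.swap i j m = k
  · rw [if_pos h, if_pos]
    rw [← h, Equiv.swap_apply_self]
  · rw [if_neg h, if_neg]
    intro hm
    apply h
    rw [hm, Equiv.swap_apply_self]

/-- The centred box is invariant under the coordinate swap. [folklore] -/
theorem comp_swap_mem_box {L : ℕ} {x : Site 4} (hx : x ∈ box 4 L) (i j : Fin 4) :
    (x ∘ Equiv.swap i j) ∈ box 4 L := by
  rw [mem_box] at hx ⊢
  exact fun m => hx _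

/-- Sites on the mirror `x i = x j` are fixed by the coordinate swap. [folklore] -/
theorem comp_swap_of_apply_eq {i j : Fin 4} {x : Site 4} (hx : x i = x j) : (x ∘ Equiv.swap i j) = x
    := by
  funext m
  simp only [Function.comp_apply, Equiv.swap_apply_def]
  split_ifs with h1 h2
  · rw [h1]; exact hx.symm
  · rw [h2]; exact hx
  · rfl

/-- `e_{σ k}` evaluated at `i` is `e_k` evaluated at `j`. [folklore] -/
theorem single_swap_apply_left (i j k : Fin 4) :
    (Pi.single (Equiv.swap i j k) (1 : ℤ) : Site 4) i = (Pi.single k (1 : ℤ) : Site 4) j := by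
  revert i j k
  decide

/-- `e_{σ k}` evaluated at `j` is `e_k` evaluated at `i`. [folklore] -/
theorem single_swap_apply_right (i j k : Fin 4) :
    (Pi.single (Equiv.swap i j k) (1 : ℤ) : Site 4) j = (Pi.single k (1 : ℤ) : Site 4) i := by
  revert i j k
  decide

/-- Sorting the reflected plane pair: for `k < l` the images `σ k`, `σ l` are comparable and
distinct. [folklore] -/
theorem swap_lt_or_lt : ∀ i j k l : Fin 4, k < l →
    Equiv.swap i j k < Equiv.swap i j l ∨ Equiv.swap i j l < Equiv.swap i j k := by
  decide

/-- Membership in `plaquettesIn Λ`, unfolded. [folklore] -/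
theorem mem_plaquettesIn_iff {Λ : Finset (Site 4)} {p : Site 4 × Fin 4 × Fin 4} :
    p ∈ plaquettesIn Λ ↔ p.1 ∈ Λ ∧ p.2.1 < p.2.2 ∧ p.1 + Pi.single p.2.1 1 ∈ Λ ∧
      p.1 + Pi.single p.2.2 1 ∈ Λ ∧ p.1 + Pi.single p.2.1 1 + Pi.single p.2.2 1 ∈ Λ := by
  simp only [plaquettesIn, Finset.mem_filter, Finset.mem_product, Finset.mem_univ, and_true]

/-- The reflection of plaquettes (base point swapped, plane pair swapped and re-sorted) maps the
plaquettes of the box to plaquettes of the box. [folklore] -/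
theorem reflPlaq_mem_plaquettesIn (i j : Fin 4) {L : ℕ} {p : Site 4 × Fin 4 × Fin 4}
    (hp : p ∈ plaquettesIn (box 4 L)) : (if Equiv.swap i j p.2.1 < Equiv.swap i j p.2.2 then (p.1 ∘
        Equiv.swap i j, Equiv.swap i j p.2.1, Equiv.swap i j p.2.2) else (p.1 ∘ Equiv.swap i j,
        Equiv.swap i j p.2.2, Equiv.swap i j p.2.1) : Site 4 × Fin 4 × Fin 4) ∈ plaquettesIn (box 4
        L) := by
  obtain ⟨x, k, l⟩ := p
  rw [mem_plaquettesIn_iff] at hp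
  obtain ⟨hx, hkl, hk, hl, hkl'⟩ := hp
  have h1 := comp_swap_mem_box hx i j
  have h2 := comp_swap_mem_box hk i j
  have h3 := comp_swap_mem_box hl i j
  have h4 := comp_swap_mem_box hkl' i j
  rw [add_single_comp_swap] at h2 h3 h4
  rw [add_single_comp_swap] at h4
  dsimp only
  split_ifs with h
  · exact mem_plaquettesIn_iff.2 ⟨h1, h, h2, h3, h4⟩
  · refine mem_plaquettesIn_iff.2 ⟨h1, (swap_lt_or_lt i j k l hkl).resolve_left h, h3, h2, ?_⟩
    rwa [add_right_comm]

/-- The reflection of plaquettes is an involution (on pairs `k < l`). [folklore] -/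
theorem reflPlaq_reflPlaq (i j : Fin 4) {p : Site 4 × Fin 4 × Fin 4} (hp : p.2.1 < p.2.2) :
    (fun q : Site 4 × Fin 4 × Fin 4 => (if Equiv.swap i j q.2.1 < Equiv.swap i j q.2.2 then (q.1 ∘
        Equiv.swap i j, Equiv.swap i j q.2.1, Equiv.swap i j q.2.2) else (q.1 ∘ Equiv.swap i j,
        Equiv.swap i j q.2.2, Equiv.swap i j q.2.1) : Site 4 × Fin 4 × Fin 4)) ((fun q : Site 4 ×
        Fin 4 × Fin 4 => (if Equiv.swap i j q.2.1 < Equiv.swap i j q.2.2 then (q.1 ∘ Equiv.swap i j,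
        Equiv.swap i j q.2.1, Equiv.swap i j q.2.2) else (q.1 ∘ Equiv.swap i j, Equiv.swap i j
        q.2.2, Equiv.swap i j q.2.1) : Site 4 × Fin 4 × Fin 4)) p) = p := by
  obtain ⟨x, k, l⟩ := p
  simp only at hp
  by_cases h : Equiv.swap i j k < Equiv.swap i j l
  · simp only [h, ↓reduceIte, Equiv.swap_apply_self, hp, swapSite_swapSite]
  · have h' : ¬ l < k := not_lt.2 hp.le
    simp only [h, ↓reduceIte, Equiv.swap_apply_self, h', swapSite_swapSite]

end SwapGeometry

/-! ## Classification of plaquettes and links with respect to the mirror `x i = x j`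

Levels `x i - x j` of the four corners `x, x + e_k, x + e_l, x + e_k + e_l` of a plaquette
`(x, k, l)`: *positive* = all corners in the closed half `x j ≤ x i` and not all on the mirror,
*negative* = the mirror image, *mirror* = all corners on the mirror, *cut* = the `(i, j)`-plaquettes
based on the mirror (corner levels `0, 1, -1, 0`). Links: *positive* = both endpoints in the closed
positive half (the hypothesis on `B` in the theorem), *mirror* = both endpoints on the mirror. -/

section Classification

variable {i j : Fin 4}

/-- The four classes exhaust the plaquettes `(x, k, l)`, `k < l` (for `i < j`). [folklore] -/
theorem plaq_class_cases (hij : i < j) {p : Site 4 × Fin 4 × Fin 4} (hp : p.2.1 < p.2.2) :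
    ((p.1 j ≤ p.1 i ∧ (p.1 + Pi.single p.2.1 1 : Site 4) j ≤ (p.1 + Pi.single p.2.1 1 : Site 4) i ∧
        (p.1 + Pi.single p.2.2 1 : Site 4) j ≤ (p.1 + Pi.single p.2.2 1 : Site 4) i ∧ (p.1 +
        Pi.single p.2.1 1 + Pi.single p.2.2 1 : Site 4) j ≤ (p.1 + Pi.single p.2.1 1 + Pi.single
        p.2.2 1 : Site 4) i) ∧ ¬ (p.1 i = p.1 j ∧ (p.1 + Pi.single p.2.1 1 : Site 4) i = (p.1 +
        Pi.single p.2.1 1 : Site 4) j ∧ (p.1 + Pi.single p.2.2 1 : Site 4) i = (p.1 + Pi.single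
        p.2.2 1 : Site 4) j)) ∨ ((p.1 i ≤ p.1 j ∧ (p.1 + Pi.single p.2.1 1 : Site 4) i ≤ (p.1 +
        Pi.single p.2.1 1 : Site 4) j ∧ (p.1 + Pi.single p.2.2 1 : Site 4) i ≤ (p.1 + Pi.single
        p.2.2 1 : Site 4) j ∧ (p.1 + Pi.single p.2.1 1 + Pi.single p.2.2 1 : Site 4) i ≤ (p.1 +
        Pi.single p.2.1 1 + Pi.single p.2.2 1 : Site 4) j) ∧ ¬ (p.1 i = p.1 j ∧ (p.1 + Pi.single
        p.2.1 1 : Site 4) i = (p.1 + Pi.single p.2.1 1 : Site 4) j ∧ (p.1 + Pi.single p.2.2 1 : Site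
        4) i = (p.1 + Pi.single p.2.2 1 : Site 4) j)) ∨ (p.1 i = p.1 j ∧ (p.1 + Pi.single p.2.1 1 :
        Site 4) i = (p.1 + Pi.single p.2.1 1 : Site 4) j ∧ (p.1 + Pi.single p.2.2 1 : Site 4) i =
        (p.1 + Pi.single p.2.2 1 : Site 4) j) ∨ (p.2.1 = i ∧ p.2.2 = j ∧ p.1 i = p.1 j) := by
  obtain ⟨x, k, l⟩ := p
  simp only at hp ⊢
  simp only [Pi.add_apply, Pi.single_apply]
  split_ifs <;> omega

/-- Negative plaquettes are not positive. [folklore] -/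
theorem not_pos_of_neg {p : Site 4 × Fin 4 × Fin 4} (h : ((p.1 i ≤ p.1 j ∧ (p.1 + Pi.single p.2.1 1
    : Site 4) i ≤ (p.1 + Pi.single p.2.1 1 : Site 4) j ∧ (p.1 + Pi.single p.2.2 1 : Site 4) i ≤ (p.1
    + Pi.single p.2.2 1 : Site 4) j ∧ (p.1 + Pi.single p.2.1 1 + Pi.single p.2.2 1 : Site 4) i ≤
    (p.1 + Pi.single p.2.1 1 + Pi.single p.2.2 1 : Site 4) j) ∧ ¬ (p.1 i = p.1 j ∧ (p.1 + Pi.single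
    p.2.1 1 : Site 4) i = (p.1 + Pi.single p.2.1 1 : Site 4) j ∧ (p.1 + Pi.single p.2.2 1 : Site 4)
    i = (p.1 + Pi.single p.2.2 1 : Site 4) j))) : ¬ ((p.1 j ≤ p.1 i ∧ (p.1 + Pi.single p.2.1 1 :
    Site 4) j ≤ (p.1 + Pi.single p.2.1 1 : Site 4) i ∧ (p.1 + Pi.single p.2.2 1 : Site 4) j ≤ (p.1 +
    Pi.single p.2.2 1 : Site 4) i ∧ (p.1 + Pi.single p.2.1 1 + Pi.single p.2.2 1 : Site 4) j ≤ (p.1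
    + Pi.single p.2.1 1 + Pi.single p.2.2 1 : Site 4) i) ∧ ¬ (p.1 i = p.1 j ∧ (p.1 + Pi.single p.2.1
    1 : Site 4) i = (p.1 + Pi.single p.2.1 1 : Site 4) j ∧ (p.1 + Pi.single p.2.2 1 : Site 4) i =
    (p.1 + Pi.single p.2.2 1 : Site 4) j)) := by
  obtain ⟨x, k, l⟩ := p
  simp only at h ⊢
  simp only [Pi.add_apply] at h ⊢
  omega

/-- Cut plaquettes are neither positive nor negative nor mirror plaquettes (`i ≠ j`). [folklore] -/
theorem not_pos_neg_mir_of_cut (hij : i ≠ j) {p : Site 4 × Fin 4 × Fin 4} (h : (p.2.1 = i ∧ p.2.2 =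
    j ∧ p.1 i = p.1 j)) :
    ¬ ((p.1 j ≤ p.1 i ∧ (p.1 + Pi.single p.2.1 1 : Site 4) j ≤ (p.1 + Pi.single p.2.1 1 : Site 4) i
        ∧ (p.1 + Pi.single p.2.2 1 : Site 4) j ≤ (p.1 + Pi.single p.2.2 1 : Site 4) i ∧ (p.1 +
        Pi.single p.2.1 1 + Pi.single p.2.2 1 : Site 4) j ≤ (p.1 + Pi.single p.2.1 1 + Pi.single
        p.2.2 1 : Site 4) i) ∧ ¬ (p.1 i = p.1 j ∧ (p.1 + Pi.single p.2.1 1 : Site 4) i = (p.1 +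
        Pi.single p.2.1 1 : Site 4) j ∧ (p.1 + Pi.single p.2.2 1 : Site 4) i = (p.1 + Pi.single
        p.2.2 1 : Site 4) j)) ∧ ¬ ((p.1 i ≤ p.1 j ∧ (p.1 + Pi.single p.2.1 1 : Site 4) i ≤ (p.1 +
        Pi.single p.2.1 1 : Site 4) j ∧ (p.1 + Pi.single p.2.2 1 : Site 4) i ≤ (p.1 + Pi.single
        p.2.2 1 : Site 4) j ∧ (p.1 + Pi.single p.2.1 1 + Pi.single p.2.2 1 : Site 4) i ≤ (p.1 +
        Pi.single p.2.1 1 + Pi.single p.2.2 1 : Site 4) j) ∧ ¬ (p.1 i = p.1 j ∧ (p.1 + Pi.single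
        p.2.1 1 : Site 4) i = (p.1 + Pi.single p.2.1 1 : Site 4) j ∧ (p.1 + Pi.single p.2.2 1 : Site
        4) i = (p.1 + Pi.single p.2.2 1 : Site 4) j)) ∧ ¬ (p.1 i = p.1 j ∧ (p.1 + Pi.single p.2.1 1
        : Site 4) i = (p.1 + Pi.single p.2.1 1 : Site 4) j ∧ (p.1 + Pi.single p.2.2 1 : Site 4) i =
        (p.1 + Pi.single p.2.2 1 : Site 4) j) := by
  obtain ⟨x, k, l⟩ := p
  simp only at h ⊢
  obtain ⟨rfl, rfl, h⟩ := h
  simp only [Pi.add_apply, Pi.single_apply, if_pos, if_neg hij, if_neg hij.symm]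
  omega

/-- Mirror plaquettes are fixed by the reflection (their plane avoids `i, j`, their base point lies
on the mirror). [folklore] -/
theorem reflPlaq_of_mir (hij : i < j) {p : Site 4 × Fin 4 × Fin 4} (hp : p.2.1 < p.2.2)
    (h : (p.1 i = p.1 j ∧ (p.1 + Pi.single p.2.1 1 : Site 4) i = (p.1 + Pi.single p.2.1 1 : Site 4)
        j ∧ (p.1 + Pi.single p.2.2 1 : Site 4) i = (p.1 + Pi.single p.2.2 1 : Site 4) j)) : (if
        Equiv.swap i j p.2.1 < Equiv.swap i j p.2.2 then (p.1 ∘ Equiv.swap i j, Equiv.swap i j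
        p.2.1, Equiv.swap i j p.2.2) else (p.1 ∘ Equiv.swap i j, Equiv.swap i j p.2.2, Equiv.swap i
        j p.2.1) : Site 4 × Fin 4 × Fin 4) = p := by
  obtain ⟨x, k, l⟩ := p
  simp only at hp h ⊢
  simp only [Pi.add_apply, Pi.single_apply] at h
  have hki : k ≠ i := by intro hc; subst hc; simp only [↓reduceIte, if_neg hij.ne'] at h; omega
  have hkj : k ≠ j := by intro hc; subst hc; simp only [↓reduceIte, if_neg hij.ne] at h; omega
  have hli : l ≠ i := by intro hc; subst hc; simp only [↓reduceIte, if_neg hij.ne'] at h; omega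
  have hlj : l ≠ j := by intro hc; subst hc; simp only [↓reduceIte, if_neg hij.ne] at h; omega
  rw [Equiv.swap_apply_of_ne_of_ne hki hkj, Equiv.swap_apply_of_ne_of_ne hli hlj, if_pos hp,
    comp_swap_of_apply_eq h.1]

/-- The four links of a positive plaquette are positive links. [folklore] -/
theorem posE_of_pos {p : Site 4 × Fin 4 × Fin 4} (h : ((p.1 j ≤ p.1 i ∧ (p.1 + Pi.single p.2.1 1 :
    Site 4) j ≤ (p.1 + Pi.single p.2.1 1 : Site 4) i ∧ (p.1 + Pi.single p.2.2 1 : Site 4) j ≤ (p.1 +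
    Pi.single p.2.2 1 : Site 4) i ∧ (p.1 + Pi.single p.2.1 1 + Pi.single p.2.2 1 : Site 4) j ≤ (p.1
    + Pi.single p.2.1 1 + Pi.single p.2.2 1 : Site 4) i) ∧ ¬ (p.1 i = p.1 j ∧ (p.1 + Pi.single p.2.1
    1 : Site 4) i = (p.1 + Pi.single p.2.1 1 : Site 4) j ∧ (p.1 + Pi.single p.2.2 1 : Site 4) i =
    (p.1 + Pi.single p.2.2 1 : Site 4) j))) :
    ((p.1 : Site 4) j ≤ (p.1 : Site 4) i ∧ (p.1 + Pi.single p.2.1 (1 : ℤ) : Site 4) j ≤ (p.1 +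
        Pi.single p.2.1 (1 : ℤ) : Site 4) i) ∧ ((p.1 + Pi.single p.2.1 1 : Site 4) j ≤ (p.1 +
        Pi.single p.2.1 1 : Site 4) i ∧ (p.1 + Pi.single p.2.1 1 + Pi.single p.2.2 (1 : ℤ) : Site 4)
        j ≤ (p.1 + Pi.single p.2.1 1 + Pi.single p.2.2 (1 : ℤ) : Site 4) i) ∧
      ((p.1 + Pi.single p.2.2 1 : Site 4) j ≤ (p.1 + Pi.single p.2.2 1 : Site 4) i ∧ (p.1 +
          Pi.single p.2.2 1 + Pi.single p.2.1 (1 : ℤ) : Site 4) j ≤ (p.1 + Pi.single p.2.2 1 +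
          Pi.single p.2.1 (1 : ℤ) : Site 4) i) ∧ ((p.1 : Site 4) j ≤ (p.1 : Site 4) i ∧ (p.1 +
          Pi.single p.2.2 (1 : ℤ) : Site 4) j ≤ (p.1 + Pi.single p.2.2 (1 : ℤ) : Site 4) i) := by
  obtain ⟨x, k, l⟩ := p
  simp only at h ⊢
  simp only [Pi.add_apply] at h ⊢
  omega

/-- The four links of a mirror plaquette are mirror links. [folklore] -/
theorem mirE_of_mir {p : Site 4 × Fin 4 × Fin 4} (h : (p.1 i = p.1 j ∧ (p.1 + Pi.single p.2.1 1 :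
    Site 4) i = (p.1 + Pi.single p.2.1 1 : Site 4) j ∧ (p.1 + Pi.single p.2.2 1 : Site 4) i = (p.1 +
    Pi.single p.2.2 1 : Site 4) j)) :
    ((p.1 : Site 4) i = (p.1 : Site 4) j ∧ (p.1 + Pi.single p.2.1 (1 : ℤ) : Site 4) i = (p.1 +
        Pi.single p.2.1 (1 : ℤ) : Site 4) j) ∧ ((p.1 + Pi.single p.2.1 1 : Site 4) i = (p.1 +
        Pi.single p.2.1 1 : Site 4) j ∧ (p.1 + Pi.single p.2.1 1 + Pi.single p.2.2 (1 : ℤ) : Site 4)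
        i = (p.1 + Pi.single p.2.1 1 + Pi.single p.2.2 (1 : ℤ) : Site 4) j) ∧
      ((p.1 + Pi.single p.2.2 1 : Site 4) i = (p.1 + Pi.single p.2.2 1 : Site 4) j ∧ (p.1 +
          Pi.single p.2.2 1 + Pi.single p.2.1 (1 : ℤ) : Site 4) i = (p.1 + Pi.single p.2.2 1 +
          Pi.single p.2.1 (1 : ℤ) : Site 4) j) ∧ ((p.1 : Site 4) i = (p.1 : Site 4) j ∧ (p.1 +
          Pi.single p.2.2 (1 : ℤ) : Site 4) i = (p.1 + Pi.single p.2.2 (1 : ℤ) : Site 4) j) := by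
  obtain ⟨x, k, l⟩ := p
  simp only at h ⊢
  simp only [Pi.add_apply] at h ⊢
  omega

/-- Mirror links are positive links. [folklore] -/
theorem posE_of_mirE {e : Site 4 × Fin 4} (h : (e.1 i = e.1 j ∧ (e.1 + Pi.single e.2 (1 : ℤ) : Site
    4) i = (e.1 + Pi.single e.2 (1 : ℤ) : Site 4) j)) : (e.1 j ≤ e.1 i ∧ (e.1 + Pi.single e.2 (1 :
    ℤ) : Site 4) j ≤ (e.1 + Pi.single e.2 (1 : ℤ) : Site 4) i) := by
  obtain ⟨x, k⟩ := e
  simp only at h ⊢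
  omega

/-- The two links `(y, i)`, `(y + e_i, j)` of the positive half of a cut plaquette are positive
links. [folklore] -/
theorem posE_of_cut (hij : i ≠ j) {y : Site 4} (hy : y i = y j) :
    ((y : Site 4) j ≤ (y : Site 4) i ∧ (y + Pi.single i (1 : ℤ) : Site 4) j ≤ (y + Pi.single i (1 :
        ℤ) : Site 4) i) ∧ ((y + Pi.single i 1 : Site 4) j ≤ (y + Pi.single i 1 : Site 4) i ∧ (y +
        Pi.single i 1 + Pi.single j (1 : ℤ) : Site 4) j ≤ (y + Pi.single i 1 + Pi.single j (1 : ℤ) :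
        Site 4) i) := by
  simp only [Pi.add_apply, Pi.single_apply, if_pos, if_neg hij, if_neg hij.symm]
  omega

/-- Mirror links are fixed by the reflection. [folklore] -/
theorem reflEdge_of_mirE (hij : i ≠ j) {e : Site 4 × Fin 4} (h : (e.1 i = e.1 j ∧ (e.1 + Pi.single
    e.2 (1 : ℤ) : Site 4) i = (e.1 + Pi.single e.2 (1 : ℤ) : Site 4) j)) : (e.1 ∘ Equiv.swap i j,
    Equiv.swap i j e.2) = e := by
  obtain ⟨y, m⟩ := e
  simp only at h ⊢
  simp only [Pi.add_apply, Pi.single_apply] at h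
  have hmi : m ≠ i := by intro hc; subst hc; simp only [↓reduceIte, if_neg hij.symm] at h; omega
  have hmj : m ≠ j := by intro hc; subst hc; simp only [↓reduceIte, if_neg hij] at h; omega
  rw [comp_swap_of_apply_eq h.1, Equiv.swap_apply_of_ne_of_ne hmi hmj]

/-- The reflection of a positive link that is not a mirror link is not positive (it lies in the
negative half with an endpoint off the mirror). [folklore] -/
theorem not_posE_reflEdge {e : Site 4 × Fin 4} (h : (e.1 j ≤ e.1 i ∧ (e.1 + Pi.single e.2 (1 : ℤ) :
    Site 4) j ≤ (e.1 + Pi.single e.2 (1 : ℤ) : Site 4) i)) (h' : ¬ (e.1 i = e.1 j ∧ (e.1 + Pi.single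
    e.2 (1 : ℤ) : Site 4) i = (e.1 + Pi.single e.2 (1 : ℤ) : Site 4) j)) :
    ¬ (((e.1 ∘ Equiv.swap i j, Equiv.swap i j e.2)).1 j ≤ ((e.1 ∘ Equiv.swap i j, Equiv.swap i j
        e.2)).1 i ∧ (((e.1 ∘ Equiv.swap i j, Equiv.swap i j e.2)).1 + Pi.single ((e.1 ∘ Equiv.swap i
        j, Equiv.swap i j e.2)).2 (1 : ℤ) : Site 4) j ≤ (((e.1 ∘ Equiv.swap i j, Equiv.swap i j
        e.2)).1 + Pi.single ((e.1 ∘ Equiv.swap i j, Equiv.swap i j e.2)).2 (1 : ℤ) : Site 4) i) :=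
        by
  obtain ⟨y, m⟩ := e
  simp only at h h' ⊢
  simp only [Function.comp_apply, Pi.add_apply, Equiv.swap_apply_left, Equiv.swap_apply_right,
    single_swap_apply_left, single_swap_apply_right] at h h' ⊢
  omega

/-- The reflection of links is an involution. [folklore] -/
theorem reflEdge_reflEdge (i j : Fin 4) (e : Site 4 × Fin 4) :
    (((e.1 ∘ Equiv.swap i j)) ∘ Equiv.swap i j, Equiv.swap i j (Equiv.swap i j e.2)) = e := by
  obtain ⟨y, m⟩ := e
  simp only [swapSite_swapSite, Equiv.swap_apply_self]

end Classification


end SwapRP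

/-- **Registered sub-goal `SwapReflectionPositivityGeometry`** (part 1/4 of stub `SwapReflectionPositivity`):
the reflection of plaquettes in the diagonal mirror (base point swapped, plane pair swapped and
re-sorted) maps the plaquettes of the box `{-L,…,L}⁴` to plaquettes of the box. [folklore] -/
theorem SwapReflectionPositivityGeometry : ∀ (i j : Fin 4) (L : ℕ) (p : Literature.Probability.LatticeModels.Site 4 × Fin 4 × Fin 4), p ∈ Literature.MathematicalPhysics.QuantumFieldTheory.plaquettesIn (Literature.Probability.LatticeModels.box 4 L) → (if Equiv.swap i j p.2.1 < Equiv.swap i j p.2.2 then (p.1 ∘ Equiv.swap i j, Equiv.swap i j p.2.1, Equiv.swap i j p.2.2) else (p.1 ∘ Equiv.swap i j, Equiv.swap i j p.2.2, Equiv.swap i j p.2.1)) ∈ Literature.MathematicalPhysics.QuantumFieldTheory.plaquettesIn (Literature.Probability.LatticeModels.box 4 L) := by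
  intro i j L p hp
  exact SwapRP.reflPlaq_mem_plaquettesIn i j hp

end Summit.QuantumFields.YangMills.Theorems.CurvatureKernel

end
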